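import Literature.NumberTheory.Sieve.ThetaIdealFibres
import HarnessLib

/-!
# The Hecke-character expansion of `Θ_{Ω'}(χ)`: orthogonality over `U⁺/U_𝔣`

Topic `Literature/NumberTheory/Sieve`, sub-namespace `ThetaUnits` (continued). With
`theta_eq_sum_periodize` (`ThetaIdealFibres`) and the Fourier expansion of periodized bumps
(`PeriodizeSmooth.hasSum_echar_periodize`) the smooth character sum becomes a series over the
frequencies `k` of the unit torus `logSpace K / L_𝔣`; summing the characters `χ(r_q) λ_k(r_q)` over
the coset representatives `r_q` of `U_𝔣` in `U⁺` kills every frequency `k` for which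
`χ λ_k` is non-trivial on `U⁺` (Mitsui 1956 §3; Hecke 1920 §1):

* `psiHom χ k : U⁺ →* ℂ`, `u ↦ χ(u) λ_k(u)`; trivial on `U_𝔣`; `psiBar χ k : U⁺/U_𝔣 →* ℂ`;
* `sum_cosets_psi` — `∑_q χ(r_q) λ_k(r_q) = #(U⁺/U_𝔣) · 1[psiBar χ k = 1]`;
* `t_coset`, `h_coset` — on `r_q ω₀` the norm coordinate is that of `ω₀` and the torus coordinate is
  shifted by `log r_q`;
* **`theta_hecke_expansion`** —
  `Θ_{Ω'}(χ) = #(U⁺/U_𝔣) ∑_{𝔭 ∈ P} ∑'_k 1[psiBar χ k = 1] c_k(t_𝔭) χ(ω₀(𝔭)) λ_k(ω₀(𝔭))`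
  with `c_k(t) = vol(fdom)⁻¹ ∫ Φ_t e_{−k}`, every series absolutely convergent.

## References

* T. Mitsui, Jap. J. Math. 26 (1956), §3. [cite: Mitsui1956, §3]
* E. Hecke, Math. Z. 6 (1920), §1. [cite: HeckeMathZ1920, §1]
-/

noncomputable section

open NumberField NumberField.InfinitePlace NumberField.Units NumberField.Units.dirichletUnitTheorem
  Literature.NumberTheory.LFunctions Literature.NumberTheory.LFunctions.HeckeCone
  Literature.NumberTheory.LFunctions.AbelianDensity
  Literature.NumberTheory.Sieve.UnitKernel Literature.NumberTheory.Sieve.UnitPeriodic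
  Literature.Algebra.EuclideanLattices.LatticePeriodic Module MeasureTheory
  Literature.NumberTheory.Sieve.NumberFieldLS Literature.NumberTheory.Sieve.SmoothTypeOne
  Literature.NumberTheory.Sieve.BoxPrimes Literature.NumberTheory.Sieve.TypeTwoBlock
  Literature.NumberTheory.Sieve.TypeTwoReparam Literature.NumberTheory.Sieve.SmoothSmallModuli
open scoped Classical

namespace Literature.NumberTheory.Sieve.ThetaUnits

variable {K : Type*} [Field K] [NumberField K] [IsTotallyReal K]

local notation "RP" => {w : InfinitePlace K // IsReal w}
local notation "rkE" => finrank ℝ (logSpace K)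

variable {𝔣 : Ideal (𝓞 K)} (χ : AddChar (Additive ((𝓞 K ⧸ 𝔣)ˣ)) ℂ) [IsZLattice ℝ (kerLattice χ)]

/-! ## The characters `u ↦ χ(u) λ_k(u)` of `U⁺/U_𝔣` -/

/-- `ψ_k(u) = χ(u) λ_k(u)` on `U⁺`, a homomorphism to `ℂ`. [cite: HeckeMathZ1920, §1] -/
def psiHom (k : Fin rkE → ℤ) : posUnits K →* ℂ where
  toFun u := unitChar χ (u : (𝓞 K)ˣ) * lam χ k ((((u : posUnits K) : (𝓞 K)ˣ) : 𝓞 K) : K)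
  map_one' := by
    simp only [OneMemClass.coe_one, map_one, Units.val_one, one_mul]
    exact_mod_cast lam_one χ k
  map_mul' u v := by
    have hu : ((((u : posUnits K) : (𝓞 K)ˣ) : 𝓞 K) : K) ≠ 0 := by exact_mod_cast (u : (𝓞 K)ˣ).ne_zero
    have hv : ((((v : posUnits K) : (𝓞 K)ˣ) : 𝓞 K) : K) ≠ 0 := by exact_mod_cast (v : (𝓞 K)ˣ).ne_zero
    simp only [Subgroup.coe_mul, Units.val_mul]
    rw [map_mul (unitChar χ)]
    push_cast
    rw [lam_mul χ k hu hv]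
    ring

omit [IsTotallyReal K] in
/-- Unfolding `psiHom`. [folklore] -/
theorem psiHom_apply (k : Fin rkE → ℤ) (u : posUnits K) :
    psiHom χ k u = unitChar χ (u : (𝓞 K)ˣ) * lam χ k ((((u : posUnits K) : (𝓞 K)ˣ) : 𝓞 K) : K) := rfl

omit [IsTotallyReal K] in
/-- `ψ_k` is trivial on `U_𝔣`. [folklore] -/
theorem Hsub_le_ker_psiHom (k : Fin rkE → ℤ) : Hsub χ ≤ (psiHom χ k).ker := by
  intro u hu
  rw [MonoidHom.mem_ker, psiHom_apply]
  have hu' := (mem_Hsub χ).1 hu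
  rw [(mem_kerPosUnits.1 hu').2, lam_unit_of_mem χ k hu', one_mul]

/-- `ψ̄_k : U⁺/U_𝔣 →* ℂ`. [folklore] -/
def psiBar (k : Fin rkE → ℤ) : posUnits K ⧸ Hsub χ →* ℂ := QuotientGroup.lift (Hsub χ) (psiHom χ k) (Hsub_le_ker_psiHom χ k)

omit [IsTotallyReal K] in
/-- `ψ̄_k (q) = ψ_k (q.out)`. [folklore] -/
theorem psiBar_apply_eq_out (k : Fin rkE → ℤ) (q : posUnits K ⧸ Hsub χ) : psiBar χ k q = psiHom χ k q.out := by
  conv_lhs => rw [← QuotientGroup.out_eq' q]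
  rfl

omit [IsTotallyReal K] in
/-- **Orthogonality over the cosets**: `∑_q χ(r_q) λ_k(r_q) = #(U⁺/U_𝔣) · 1[ψ̄_k = 1]`.
[cite: HeckeMathZ1920, §1] -/
theorem sum_cosets_psi [Fintype (posUnits K ⧸ Hsub χ)] (k : Fin rkE → ℤ) :
    ∑ q : posUnits K ⧸ Hsub χ, psiHom χ k q.out =
      if psiBar χ k = 1 then (Fintype.card (posUnits K ⧸ Hsub χ) : ℂ) else 0 := by
  have h := sum_hom_units (psiBar χ k)
  rw [Finset.sum_congr rfl fun q _ => (psiBar_apply_eq_out χ k q)] at h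
  rw [h]
  split_ifs <;> simp

/-! ## Coordinates of `r_q ω₀` -/

omit [IsZLattice ℝ (kerLattice χ)] [IsTotallyReal K] in
/-- On `r ω₀` (`r` a unit) the norm coordinate is that of `ω₀` and the torus coordinate is shifted
by `log r`. [folklore] -/
theorem toTH_logVec_unit_mul (r : (𝓞 K)ˣ) {ω₀ : 𝓞 K} (hω₀ : ω₀ ≠ 0) :
    toTH K (logVec K ((((r : 𝓞 K) * ω₀ : 𝓞 K) : K))) =
      ((toTH K (logVec K (ω₀ : K))).1, logEmbedding K (Additive.ofMul r) + (toTH K (logVec K (ω₀ : K))).2) := by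
  push_cast
  rw [logVec_mul (by exact_mod_cast r.ne_zero) (by exact_mod_cast hω₀), toTH_add, toTH_logVec_unit]
  ext <;> simp

/-! ## The expansion -/

/-- The Fourier coefficient `c_k(t) = vol(fdom L_𝔣)⁻¹ ∫ Φ_t e_{−k}` of the periodized weight.
[cite: HeckeMathZ1920, §1] -/
def coeff (kf : RP → ℝ → ℝ) (M t : ℝ) (k : Fin rkE → ℤ) : ℂ :=
  ((volume : Measure (logSpace K)).real (fdom (kerLattice χ)))⁻¹ *
    ∫ y, (PhiT K kf M t y : ℂ) * echar (kerLattice χ) (-k) y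

/-- `Λ_k(ω) = χ(ω) λ_k(ω)`, the value at a generator. [cite: HeckeMathZ1920, §1] -/
def LamGen (k : Fin rkE → ℤ) (ω : 𝓞 K) : ℂ := unitValue χ (Ideal.Quotient.mk 𝔣 ω) * lam χ k (ω : K)

omit [NumberField K] [IsTotallyReal K] [IsZLattice ℝ (kerLattice χ)] in
/-- `χ(r ω₀) = χ(r) χ(ω₀)` for a unit `r`. [folklore] -/
theorem unitValue_unit_mul (r : (𝓞 K)ˣ) (ω₀ : 𝓞 K) :
    unitValue χ (Ideal.Quotient.mk 𝔣 ((r : 𝓞 K) * ω₀)) = unitChar χ r * unitValue χ (Ideal.Quotient.mk 𝔣 ω₀) := by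
  rw [map_mul, unitValue_mul, unitChar_apply]
  congr 1
  exact unitValue_coe χ (Units.map (Ideal.Quotient.mk 𝔣).toMonoidHom r)

omit [IsTotallyReal K] in
/-- The algebra of one Fourier term on a coset: `χ(rω₀) (c e_k(log r + h₀)) = c ψ_k(r) Λ_k(ω₀)`,
`h₀ = h(ω₀)`. [folklore] -/
theorem coset_term_identity (k : Fin rkE → ℤ) (c : ℂ) (r : posUnits K) (ω₀ : 𝓞 K) :
    unitValue χ (Ideal.Quotient.mk 𝔣 ((((r : posUnits K) : (𝓞 K)ˣ) : 𝓞 K) * ω₀)) *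
        (c * echar (kerLattice χ) k (logEmbedding K (Additive.ofMul ((r : posUnits K) : (𝓞 K)ˣ)) + (toTH K (logVec K (ω₀ : K))).2)) =
      c * (psiHom χ k r * LamGen χ k ω₀) := by
  rw [echar_add, unitValue_unit_mul χ, psiHom_apply, LamGen]
  have hlr : lam χ k (((((r : posUnits K) : (𝓞 K)ˣ) : 𝓞 K) : K)) =
      echar (kerLattice χ) k (logEmbedding K (Additive.ofMul ((r : posUnits K) : (𝓞 K)ˣ))) := by
    unfold lam; rw [toTH_logVec_unit]
  rw [hlr]
  unfold lam
  ring

/-- **The coset term expanded** (split coordinates): for `r ∈ U⁺`,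
`χ(rω₀) · periodize L Φ_{t₀} (log r + h₀) = ∑'_k c_k(t₀) ψ_k(r) Λ_k(ω₀)` as a `HasSum`,
`(t₀, h₀) = toTH (logVec ω₀)`. [cite: Mitsui1956, §3] -/
theorem hasSum_coset_term {kf : RP → ℝ → ℝ} (hk : ∀ w, ContDiff ℝ (⊤ : ℕ∞) (kf w)) {a : ℝ}
    (hlo : ∀ w v, v < a - Real.log 2 → kf w v = 0) (hhi : ∀ w v, 0 < v → kf w v = 0) (M : ℝ)
    (r : posUnits K) (ω₀ : 𝓞 K) :
    HasSum (fun k : Fin rkE → ℤ => coeff χ kf M (toTH K (logVec K (ω₀ : K))).1 k * (psiHom χ k r * LamGen χ k ω₀))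
      (unitValue χ (Ideal.Quotient.mk 𝔣 ((((r : posUnits K) : (𝓞 K)ˣ) : 𝓞 K) * ω₀)) *
        (periodize (kerLattice χ) (PhiT K kf M (toTH K (logVec K (ω₀ : K))).1)
          (logEmbedding K (Additive.ofMul ((r : posUnits K) : (𝓞 K)ˣ)) + (toTH K (logVec K (ω₀ : K))).2) : ℂ)) := by
  have hexp := hasSum_echar_periodize (L := kerLattice χ) (volume : Measure (logSpace K))
    (contDiff_PhiT kf hk M (toTH K (logVec K (ω₀ : K))).1)
    (fun y hy => PhiT_eq_zero_of_norm_gt hlo hhi M (toTH K (logVec K (ω₀ : K))).1 hy)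
    (logEmbedding K (Additive.ofMul ((r : posUnits K) : (𝓞 K)ˣ)) + (toTH K (logVec K (ω₀ : K))).2)
  have hexp2 := hexp.mul_left (unitValue χ (Ideal.Quotient.mk 𝔣 ((((r : posUnits K) : (𝓞 K)ˣ) : 𝓞 K) * ω₀)))
  simp only [coset_term_identity χ] at hexp2
  exact hexp2

omit [IsZLattice ℝ (kerLattice χ)] [IsTotallyReal K] in
/-- The coset term of `theta_eq_sum_periodize` in split coordinates. [folklore] -/
theorem coset_term_split (kf : RP → ℝ → ℝ) (M : ℝ) (r : posUnits K) {ω₀ : 𝓞 K} (hω₀ : ω₀ ≠ 0) :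
    unitValue χ (Ideal.Quotient.mk 𝔣 ((((r : posUnits K) : (𝓞 K)ˣ) : 𝓞 K) * ω₀)) *
        (periodize (kerLattice χ)
          (PhiT K kf M (toTH K (logVec K (((((r : posUnits K) : (𝓞 K)ˣ) : 𝓞 K) * ω₀ : 𝓞 K) : K))).1)
          (toTH K (logVec K (((((r : posUnits K) : (𝓞 K)ˣ) : 𝓞 K) * ω₀ : 𝓞 K) : K))).2 : ℂ) =
      unitValue χ (Ideal.Quotient.mk 𝔣 ((((r : posUnits K) : (𝓞 K)ˣ) : 𝓞 K) * ω₀)) *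
        (periodize (kerLattice χ) (PhiT K kf M (toTH K (logVec K (ω₀ : K))).1)
          (logEmbedding K (Additive.ofMul ((r : posUnits K) : (𝓞 K)ˣ)) + (toTH K (logVec K (ω₀ : K))).2) : ℂ) := by
  have h := toTH_logVec_unit_mul ((r : posUnits K) : (𝓞 K)ˣ) hω₀
  have h1 : (toTH K (logVec K (((((r : posUnits K) : (𝓞 K)ˣ) : 𝓞 K) * ω₀ : 𝓞 K) : K))).1 = (toTH K (logVec K (ω₀ : K))).1 := by
    rw [h]
  have h2 : (toTH K (logVec K (((((r : posUnits K) : (𝓞 K)ˣ) : 𝓞 K) * ω₀ : 𝓞 K) : K))).2 =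
      logEmbedding K (Additive.ofMul ((r : posUnits K) : (𝓞 K)ˣ)) + (toTH K (logVec K (ω₀ : K))).2 := by
    rw [h]
  congr 3
  · exact congrArg (PhiT K kf M) h1

/-- **The Hecke-character expansion of `Θ_{Ω'}(χ)`**:
`Θ = ∑_{𝔭 ∈ P} ∑'_k (#(U⁺/U_𝔣) · 1[ψ̄_k = 1]) c_k(t_𝔭) Λ_k(ω₀(𝔭))`, each series convergent
(smooth profiles supported in `[a − log 2, 0]`, `M > 0`). [cite: Mitsui1956, §3] -/
theorem theta_hecke_expansion [Fintype (posUnits K ⧸ Hsub χ)] {kf : RP → ℝ → ℝ} (hk : ∀ w, ContDiff ℝ (⊤ : ℕ∞) (kf w))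
    {a : ℝ} (hlo : ∀ w v, v < a - Real.log 2 → kf w v = 0) (hhi : ∀ w v, 0 < v → kf w v = 0) {M : ℝ} (hM : 0 < M) :
    theta K kf M χ = ∑ 𝔭 ∈ Pset (K := K) M, ∑' k : Fin rkE → ℤ,
      (if psiBar χ k = 1 then (Fintype.card (posUnits K ⧸ Hsub χ) : ℂ) else 0) *
        (coeff χ kf M (toTH K (logVec K (gen M 𝔭 : K))).1 k * LamGen χ k (gen M 𝔭)) := by
  rw [theta_eq_sum_periodize χ hhi hM]
  refine Finset.sum_congr rfl fun 𝔭 h𝔭 => ?_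
  have h0 : gen M 𝔭 ≠ 0 := (Finset.mem_filter.1 (gen_spec h𝔭).1).2.ne_zero
  -- sum the coset expansions over `q`
  rw [Finset.sum_congr rfl fun q _ => coset_term_split χ kf M q.out h0]
  have hsum := hasSum_sum (s := (Finset.univ : Finset (posUnits K ⧸ Hsub χ)))
    fun q _ => hasSum_coset_term χ hk hlo hhi M q.out (gen M 𝔭)
  rw [← hsum.tsum_eq]
  refine tsum_congr fun k => ?_
  have hk1 : ∑ q : posUnits K ⧸ Hsub χ, coeff χ kf M (toTH K (logVec K (gen M 𝔭 : K))).1 k * (psiHom χ k q.out * LamGen χ k (gen M 𝔭)) =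
      (∑ q : posUnits K ⧸ Hsub χ, psiHom χ k q.out) * (coeff χ kf M (toTH K (logVec K (gen M 𝔭 : K))).1 k * LamGen χ k (gen M 𝔭)) := by
    rw [Finset.sum_mul]
    exact Finset.sum_congr rfl fun q _ => by ring
  rw [hk1, sum_cosets_psi]

end Literature.NumberTheory.Sieve.ThetaUnits
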